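import Mathlib

/-!
# Dimock, *The renormalization group according to Balaban* I, §2.1: the block-averaging operator `Q`, its transpose,
# `QQᵀ = I` and the projection `QᵀQ` (L317–336), `Q_k = Q^k` (L439–443) — the FINITE MATRIX MODEL behind the hypothesis
# `Q * Qᵀ = 1` of this lineage's one-step modules, PROVED for every block map with equal fibres

**Citation header (reproduction of PUBLISHED work; template of the Bałaban lattice Yang–Mills cell).**
J. Dimock, *The renormalization group according to Balaban I. Small fields*, Rev. Math. Phys. **25** (2013) 1330010
(= arXiv:1108.1335v2) [Dimock2013], §2.1 TeX L317–336 and L439–443 (TeX source held by the cell,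
`inputs/files/dimock/src/1108.1335/1108.1335.tex`, 7382e6540dded9be).  Dimock's papers are published and refereed and
are the cell's TEMPLATE, not manuscripts under audit; no quantity of the Bałaban series is touched.

**What the paper prints (verbatim).**  L317–327: *"On the lattice L^{−k}ℤ³, or any associated toroidal lattice, the
averaging operator Q takes functions f on L^{−k}ℤ³ to functions Qf on L^{−k+1}ℤ³ by (Qf)(y) = L^{−3} Σ_{x∈B(y)} f(x)  Here
B(y) is cubes of L³ sites (L on a side) in L^{−k}ℤ³ centered on y ∈ L^{−k+1}ℤ³. … The distance is |x−y| = sup_μ|x_μ − y_μ|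
and we assume L is odd."*  L328–336: *"The transpose operator Qᵀ with respect to the inner product (three0) takes functions
on L^{−k+1}ℤ³ to functions on L^{−k}ℤ³. It is computed to be (Qᵀf)(x) = f(y) if x ∈ B(y)  Then QQᵀ = I while QᵀQ is a
projection operator onto the range of Qᵀ which is functions constant on the cubes."*  L439–443: *"The various averaging
operators can be composed into a single averaging operation over large cubes. Let Q_k = Q^k be averaging operator over
cubes B_k(y) with L^{3k} sites (L^k on a side). … (Q_kf)(y) = L^{−3k} Σ_{x∈B_k(y)} f(x)"*; (three0) L206–208: *"<u,v> =
∫u(x)v(x)dx ≡ L^{−3𝖭} Σ_{x∈𝕋^{−𝖭}_𝖬} u(x)v(x)"* (so the inner product on the coarser lattice carries the relative weight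
`L³` per site).

**What is reproduced here (kernel-checked, zero `sorry`; Mathlib only).**  ABSTRACT FINITE FORM: fine sites `ι`, coarse
sites `σ` (finite types), a BLOCK MAP `b : ι → σ` whose fibres `B(y) = {x : b x = y}` all have the same size `N > 0` (the
print: the cubes `B(y)` of `N = L³` sites of a box or torus; every equal-fibre map is covered).
* §1 **the printed operators**: `QD b N f y = N⁻¹ Σ_{x∈B(y)} f x` and `QDT b g x = g (b x)` (*"(Qᵀf)(x) = f(y) if x ∈ B(y)"*);
  `QD_QDT` (**`QQᵀ = I`**: `QD (QDT g) = g`), `adjoint` (Qᵀ IS the transpose for the weighted inner products: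
  `N · Σ_y (QD f y)(g y) = Σ_x (f x)(QDT g x)` — the relative weight `N = L³` of (three0)), `QDT_QD` (`QᵀQ f x = N⁻¹Σ_{x′∈B(b x)}
  f x′` = the block average pulled back), `proj_idem` (**`QᵀQ` is a projection**), `proj_eq_self_iff` (its fixed points are
  EXACTLY the block-constant functions — *"onto the range of Qᵀ which is functions constant on the cubes"*), `proj_range`
  (`QᵀQ f` is block-constant).
* §2 **the isometric matrix form** used by `FreeFlowSingleStep` / `GaussianSingleStep` / `LocalizedSingleStep` /
  `MultiRegionFreeFlow` (there `Q : Matrix σ ι ℝ` with UNWEIGHTED dot products on both lattices): `Qmat b N y x =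
  (√N)⁻¹·[b x = y]` — the printed `Q` conjugated by the isometry `g ↦ √N·g` of the coarse lattice that removes the weight —
  with **`Qmat_mul_transpose : Qmat b N * (Qmat b N)ᵀ = 1`** (the hypothesis `hQ` of those modules is a THEOREM of the
  geometry), `Qmat_mulVec` / `Qmat_transpose_mulVec` (the two rescaled actions) and `Qmat_proj_mulVec`
  (`(Qmatᵀ Qmat) f = QᵀQ f`: the projection is the SAME operator in both normalisations).
* §3 **`Q_k = Q^k`**: `Qmat_comp` — for block maps `b₁ : ι → σ` (fibres `N₁`) and `b₂ : σ → ρ` (fibres `N₂`),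
  `Qmat b₂ N₂ * Qmat b₁ N₁ = Qmat (b₂ ∘ b₁) (N₁N₂)` and `fibre_comp_card` (the composite fibres have `N₁N₂` sites) — the matrix
  form of *"composed into a single averaging operation over large cubes"* (the function form on `ℤ^d` is this lineage's
  `BlockAveragingComposition.qavg_comp`).
* §4 instance `Fin 6 → Fin 2` (blocks of three sites).
* §5 (v1.1) **the block average is a sup-norm contraction**: `abs_QD_le` (`|(Qf)(y)| ≤ ‖f‖_∞` — an average of `N` values),
  `abs_QDT_le`, `abs_proj_Qmat_mulVec_le` (`|(QᵀQ f)(x)| ≤ ‖f‖_∞` in the isometric matrix form `(Qmatᵀ Qmat)`) — the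
  input *"|A_{k,r}W| ≤ 𝒪(1)(1+r)^{−1}‖W‖_∞"* of §4.3 LEMMA 16 via (three) `A_{k,r} = (a_k+r)^{−1}(I − QᵀQ) + (a_k + aL^{−2} +
  r)^{−1}QᵀQ` (used by `CovarianceSquareRoot`).

**Readings (declared).**  (i) Finite index types and an abstract equal-fibre block map in place of the cubes of
`L^{−k}ℤ³`/the torus; (ii) the weight of (three0) enters only as the relative factor `N` between the two lattices
(`adjoint`); the isometric form `Qmat` is this lineage's convention (declared in `FreeFlowSingleStep`'s header: *"`QQᵀ = I`"*
with dot products), equivalent to the print's by the rescaling `g ↦ √N g` on `σ`; (iii) *"L is odd"*/centering play no role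
in the algebra.

**What is NOT claimed.**  The cube geometry as a concrete `Fintype` instance beyond §4's example; the scaled densities
`dΦ^{(k)}` and normalisations (L406–435); anything of B1–B16 (Bałaban's averaging operations [B3] are the cell's
`Balaban1983to89/*` modules — e.g. pv22's `B6QGQLower276.qop` on `ℤ^d` — untouched).  NOT summit progress; NOT a statement
about any Bałaban paper; NOT continuum; NOT Clay.  Unit `b2b-balaban-template` gen 30 (journal CLAIM
D1-BLOCK-AVERAGING-MATRIX-KERNEL).

**Version.**  v1.1 — ADDITIVE to v1 (p203077, commit a3558c01de29): + §5 `abs_QD_le`, `abs_QDT_le`, `abs_proj_Qmat_mulVec_le` (sup-norm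
contraction of `Q`, `Qᵀ`, `QᵀQ`); every v1 declaration byte-identical (unit `b2b-balaban-template` gen 31, journal CLAIM
D1-BLOCK-AVERAGE-SUPNORM-KERNEL).
-/

noncomputable section

open Finset Matrix

namespace Literature.MathematicalPhysics.QuantumFieldTheory.Dimock2011to13.BlockAveragingMatrix

variable {ι σ ρ : Type*} [Fintype ι] [Fintype σ] [Fintype ρ] [DecidableEq ι] [DecidableEq σ] [DecidableEq ρ]

/-! ## §1 The printed operators `Q`, `Qᵀ`; `QQᵀ = I`; the projection `QᵀQ` -/

/-- the block (cube) over the coarse site `y`: `B(y) = {x : b x = y}`. [cite: Dimock2013, §2.1 L322–326 (arXiv:1108.1335v2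
TeX)] -/
def fibre (b : ι → σ) (y : σ) : Finset ι := univ.filter fun x => b x = y

omit [Fintype σ] [DecidableEq ι] in
/-- `x ∈ B(y) ↔ b x = y`. [cite: Dimock2013, §2.1 L322–326 (arXiv:1108.1335v2 TeX)] -/
@[simp] theorem mem_fibre {b : ι → σ} {y : σ} {x : ι} : x ∈ fibre b y ↔ b x = y := by
  simp [fibre]

/-- **`Q`**: `(Qf)(y) = N⁻¹ Σ_{x∈B(y)} f(x)` (print: `N = L³`). [cite: Dimock2013, §2.1 L317–321 (arXiv:1108.1335v2 TeX)] -/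
def QD (b : ι → σ) (N : ℕ) (f : ι → ℝ) (y : σ) : ℝ := (N : ℝ)⁻¹ * ∑ x ∈ fibre b y, f x

/-- **`Qᵀ`**: *"(Qᵀf)(x) = f(y) if x ∈ B(y)"*. [cite: Dimock2013, §2.1 L328–334 (arXiv:1108.1335v2 TeX)] -/
def QDT (b : ι → σ) (g : σ → ℝ) (x : ι) : ℝ := g (b x)

omit [Fintype σ] [DecidableEq ι] in
/-- a sum over a block of a block-constant function. [folklore] -/
private theorem sum_fibre_comp {b : ι → σ} {N : ℕ} (hb : ∀ y, (fibre b y).card = N) (g : σ → ℝ) (y : σ) :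
    ∑ x ∈ fibre b y, g (b x) = N * g y := by
  rw [Finset.sum_congr rfl fun x hx => by rw [mem_fibre.mp hx], Finset.sum_const, hb y, nsmul_eq_mul]

omit [Fintype σ] [DecidableEq ι] in
/-- **`QQᵀ = I`** (*"Then QQᵀ = I"*), for a block map with fibres of equal size `N > 0`. [cite: Dimock2013, §2.1 L335
(arXiv:1108.1335v2 TeX)] -/
theorem QD_QDT {b : ι → σ} {N : ℕ} (hb : ∀ y, (fibre b y).card = N) (hN : 0 < N) (g : σ → ℝ) :
    QD b N (QDT b g) = g := by
  funext y
  unfold QD QDT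
  rw [sum_fibre_comp hb g y, ← mul_assoc, inv_mul_cancel₀ (by exact_mod_cast hN.ne'), one_mul]

/-- **`Qᵀ` is the transpose of `Q` for the weighted inner products** — relative weight `N` (= `L³`, (three0)) on the coarse
lattice: `N Σ_y (Qf)(y) g(y) = Σ_x f(x) (Qᵀg)(x)`. [cite: Dimock2013, §2.1 L328–334 with (three0) L206–208 (arXiv:1108.1335v2
TeX)] -/
theorem adjoint {b : ι → σ} {N : ℕ} (hN : 0 < N) (f : ι → ℝ) (g : σ → ℝ) :
    (N : ℝ) * ∑ y, QD b N f y * g y = ∑ x, f x * QDT b g x := by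
  unfold QD QDT
  have hN' : (N : ℝ) ≠ 0 := by exact_mod_cast hN.ne'
  calc (N : ℝ) * ∑ y, (N : ℝ)⁻¹ * (∑ x ∈ fibre b y, f x) * g y
      = ∑ y, ∑ x ∈ fibre b y, f x * g y := by
        rw [Finset.mul_sum]
        refine Finset.sum_congr rfl fun y _ => ?_
        rw [← mul_assoc, ← mul_assoc, mul_inv_cancel₀ hN', one_mul, Finset.sum_mul]
    _ = ∑ y, ∑ x ∈ fibre b y, f x * g (b x) := by
        refine Finset.sum_congr rfl fun y _ => Finset.sum_congr rfl fun x hx => ?_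
        rw [mem_fibre.mp hx]
    _ = ∑ x, f x * g (b x) := by
        rw [← Finset.sum_biUnion]
        · congr 1
          ext x
          simp only [Finset.mem_biUnion, Finset.mem_univ, mem_fibre, true_and, exists_eq']
        · intro y _ y' _ hyy'
          simp only [Function.onFun]
          rw [Finset.disjoint_left]
          intro x hx hx'
          exact hyy' ((mem_fibre.mp hx).symm.trans (mem_fibre.mp hx'))

omit [Fintype σ] [DecidableEq ι] in
/-- **`QᵀQ`** is the block average pulled back to the fine lattice: `(QᵀQf)(x) = N⁻¹ Σ_{x′∈B(b x)} f(x′)`.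
[cite: Dimock2013, §2.1 L335–336 (arXiv:1108.1335v2 TeX)] -/
theorem QDT_QD (b : ι → σ) (N : ℕ) (f : ι → ℝ) (x : ι) :
    QDT b (QD b N f) x = (N : ℝ)⁻¹ * ∑ x' ∈ fibre b (b x), f x' := rfl

omit [Fintype σ] [DecidableEq ι] in
/-- **`QᵀQ` is a projection** (*"QᵀQ is a projection operator"*): idempotent. [cite: Dimock2013, §2.1 L335–336
(arXiv:1108.1335v2 TeX)] -/
theorem proj_idem {b : ι → σ} {N : ℕ} (hb : ∀ y, (fibre b y).card = N) (hN : 0 < N) (f : ι → ℝ) :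
    QDT b (QD b N (QDT b (QD b N f))) = QDT b (QD b N f) := by
  rw [QD_QDT hb hN]

omit [Fintype σ] [DecidableEq ι] in
/-- the range of `QᵀQ` consists of block-constant functions. [cite: Dimock2013, §2.1 L336 (arXiv:1108.1335v2 TeX)] -/
theorem proj_range (b : ι → σ) (N : ℕ) (f : ι → ℝ) {x x' : ι} (h : b x = b x') :
    QDT b (QD b N f) x = QDT b (QD b N f) x' := by
  unfold QDT; rw [h]

omit [Fintype σ] [DecidableEq ι] in
/-- **the fixed points of `QᵀQ` are EXACTLY the block-constant functions** (*"onto the range of Qᵀ which is functions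
constant on the cubes"*). [cite: Dimock2013, §2.1 L335–336 (arXiv:1108.1335v2 TeX)] -/
theorem proj_eq_self_iff {b : ι → σ} {N : ℕ} (hb : ∀ y, (fibre b y).card = N) (hN : 0 < N) (f : ι → ℝ) :
    QDT b (QD b N f) = f ↔ ∀ x x', b x = b x' → f x = f x' := by
  constructor
  · intro h x x' hxx'
    rw [← h]; exact proj_range b N f hxx'
  · intro h
    funext x
    rw [QDT_QD]
    have hsum : ∑ x' ∈ fibre b (b x), f x' = ∑ _x' ∈ fibre b (b x), f x :=
      Finset.sum_congr rfl fun x' hx' => h x' x (mem_fibre.mp hx')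
    rw [hsum, Finset.sum_const, hb, nsmul_eq_mul, ← mul_assoc, inv_mul_cancel₀ (by exact_mod_cast hN.ne'), one_mul]

/-! ## §2 The isometric matrix form: `Qmat Qmatᵀ = 1` -/

/-- **the one-step averaging matrix in the isometric normalisation** of this lineage's one-step modules:
`Qmat b N y x = (√N)⁻¹·[b x = y]` (the printed `Q` conjugated by `g ↦ √N g` on the coarse lattice). [cite: Dimock2013, §2.1
L317–336 (arXiv:1108.1335v2 TeX)] -/
def Qmat (b : ι → σ) (N : ℕ) : Matrix σ ι ℝ := fun y x => if b x = y then (√(N : ℝ))⁻¹ else 0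

omit [Fintype σ] [DecidableEq ι] in
/-- `Qmat f (y) = (√N)⁻¹ Σ_{x∈B(y)} f(x) = √N · (Qf)(y)`. [cite: Dimock2013, §2.1 L317–321 (arXiv:1108.1335v2 TeX)] -/
theorem Qmat_mulVec (b : ι → σ) (N : ℕ) (f : ι → ℝ) (y : σ) :
    (Qmat b N *ᵥ f) y = (√(N : ℝ))⁻¹ * ∑ x ∈ fibre b y, f x := by
  simp only [Matrix.mulVec, dotProduct, Qmat, fibre]
  rw [Finset.sum_filter, Finset.mul_sum]
  refine Finset.sum_congr rfl fun x _ => ?_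
  split_ifs <;> simp

omit [Fintype ι] [DecidableEq ι] in
/-- `Qmatᵀ g (x) = (√N)⁻¹ g(b x) = (√N)⁻¹ (Qᵀg)(x)`. [cite: Dimock2013, §2.1 L328–334 (arXiv:1108.1335v2 TeX)] -/
theorem Qmat_transpose_mulVec (b : ι → σ) (N : ℕ) (g : σ → ℝ) (x : ι) :
    ((Qmat b N)ᵀ *ᵥ g) x = (√(N : ℝ))⁻¹ * g (b x) := by
  simp only [Matrix.mulVec, dotProduct, Matrix.transpose_apply, Qmat]
  rw [Finset.sum_eq_single (b x)]
  · simp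
  · intro y _ hy; rw [if_neg (Ne.symm hy)]; ring
  · intro h; exact absurd (Finset.mem_univ _) h

omit [Fintype σ] [DecidableEq ι] in
/-- **`Qmat Qmatᵀ = 1`** — the hypothesis `hQ : Q * Qᵀ = 1` of `FreeFlowSingleStep`/`GaussianSingleStep`/`LocalizedSingleStep`
is a theorem for every block map with fibres of equal size `N > 0`. [cite: Dimock2013, §2.1 L335 (arXiv:1108.1335v2 TeX)] -/
theorem Qmat_mul_transpose {b : ι → σ} {N : ℕ} (hb : ∀ y, (fibre b y).card = N) (hN : 0 < N) :
    Qmat b N * (Qmat b N)ᵀ = 1 := by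
  ext y y'
  simp only [Matrix.mul_apply, Matrix.transpose_apply, Qmat, Matrix.one_apply]
  have hNr : (0 : ℝ) < N := by exact_mod_cast hN
  by_cases h : y = y'
  · subst h
    rw [if_pos rfl]
    have : ∀ x, (if b x = y then (√(N:ℝ))⁻¹ else 0) * (if b x = y then (√(N:ℝ))⁻¹ else 0)
        = if b x = y then ((N : ℝ))⁻¹ else 0 := by
      intro x
      split_ifs
      · rw [← mul_inv, Real.mul_self_sqrt hNr.le]
      · ring
    simp_rw [this]
    rw [← Finset.sum_filter, show univ.filter (fun x => b x = y) = fibre b y from rfl, Finset.sum_const, hb y,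
      nsmul_eq_mul, mul_inv_cancel₀ hNr.ne']
  · rw [if_neg h]
    refine Finset.sum_eq_zero fun x _ => ?_
    by_cases h1 : b x = y
    · rw [if_pos h1, if_neg (fun h2 => h (h1.symm.trans h2))]; ring
    · rw [if_neg h1]; ring

omit [DecidableEq ι] in
/-- **the projection is the same operator in both normalisations**: `(Qmatᵀ Qmat) f = QᵀQ f` (block average pulled back).
[cite: Dimock2013, §2.1 L335–336 (arXiv:1108.1335v2 TeX)] -/
theorem Qmat_proj_mulVec (b : ι → σ) {N : ℕ} (hN : 0 < N) (f : ι → ℝ) :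
    ((Qmat b N)ᵀ * Qmat b N) *ᵥ f = QDT b (QD b N f) := by
  funext x
  rw [← Matrix.mulVec_mulVec, Qmat_transpose_mulVec, Qmat_mulVec, QDT_QD, ← mul_assoc]
  congr 1
  have hNr : (0 : ℝ) < N := by exact_mod_cast hN
  rw [← mul_inv, Real.mul_self_sqrt hNr.le]

/-! ## §3 `Q_k = Q^k`: composition of block maps -/

omit [Fintype ρ] in
/-- the composite block `B_{b₂∘b₁}(z)` is the disjoint union of the blocks `B_{b₁}(y)`, `y ∈ B_{b₂}(z)`. [folklore] -/
private theorem fibre_comp_eq (b₁ : ι → σ) (b₂ : σ → ρ) (z : ρ) :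
    fibre (b₂ ∘ b₁) z = (fibre b₂ z).biUnion fun y => fibre b₁ y := by
  ext x
  simp only [mem_fibre, Function.comp_apply, Finset.mem_biUnion]
  constructor
  · intro h; exact ⟨b₁ x, h, rfl⟩
  · rintro ⟨y, hy, hxy⟩; rw [hxy]; exact hy

omit [Fintype ρ] in
/-- **composite cubes have `N₁N₂` sites** (*"cubes B_k(y) with L^{3k} sites"*). [cite: Dimock2013, §2.1 L439–443
(arXiv:1108.1335v2 TeX)] -/
theorem fibre_comp_card {b₁ : ι → σ} {b₂ : σ → ρ} {N₁ N₂ : ℕ} (hb₁ : ∀ y, (fibre b₁ y).card = N₁)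
    (hb₂ : ∀ z, (fibre b₂ z).card = N₂) (z : ρ) : (fibre (b₂ ∘ b₁) z).card = N₁ * N₂ := by
  rw [fibre_comp_eq, Finset.card_biUnion]
  · rw [Finset.sum_congr rfl fun y _ => hb₁ y, Finset.sum_const, hb₂ z, smul_eq_mul, mul_comm]
  · intro y _ y' _ hyy'
    simp only [Function.onFun]
    rw [Finset.disjoint_left]
    intro x hx hx'
    exact hyy' ((mem_fibre.mp hx).symm.trans (mem_fibre.mp hx'))

omit [Fintype ι] [Fintype ρ] [DecidableEq ι] in
/-- **`Q_k = Q^k` in matrix form**: `Qmat b₂ N₂ * Qmat b₁ N₁ = Qmat (b₂ ∘ b₁) (N₁N₂)` — *"The various averaging operators can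
be composed into a single averaging operation over large cubes"* (this lineage's `rowsO (Q * Qk)` for `Q_{k+1} = QQ_k`).
[cite: Dimock2013, §2.1 L439–443 (arXiv:1108.1335v2 TeX)] -/
theorem Qmat_comp (b₁ : ι → σ) (b₂ : σ → ρ) (N₁ N₂ : ℕ) :
    Qmat b₂ N₂ * Qmat b₁ N₁ = Qmat (b₂ ∘ b₁) (N₁ * N₂) := by
  ext z x
  simp only [Matrix.mul_apply, Qmat, Function.comp_apply]
  rw [Finset.sum_eq_single (b₁ x)]
  · rw [if_pos rfl]
    by_cases h : b₂ (b₁ x) = z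
    · rw [if_pos h, if_pos h, Nat.cast_mul, Real.sqrt_mul (Nat.cast_nonneg N₁), mul_inv, mul_comm]
    · rw [if_neg h, if_neg h]; ring
  · intro y _ hy; rw [if_neg (Ne.symm hy)]; ring
  · intro h; exact absurd (Finset.mem_univ _) h

/-! ## §4 Instance -/

/-- blocks of three sites: `b : Fin 6 → Fin 2`, `b x = x / 3`; every fibre has `3` elements, so `Qmat b 3 * (Qmat b 3)ᵀ = 1`. -/
example : Qmat (fun x : Fin 6 => (⟨x.val / 3, by omega⟩ : Fin 2)) 3
    * (Qmat (fun x : Fin 6 => (⟨x.val / 3, by omega⟩ : Fin 2)) 3)ᵀ = 1 := by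
  refine Qmat_mul_transpose (fun y => ?_) (by norm_num)
  fin_cases y <;> decide

/-! ## §5 (v1.1) The block average is a sup-norm contraction -/

omit [Fintype σ] [DecidableEq ι] in
/-- **`|(Qf)(y)| ≤ ‖f‖_∞`**: the block average `N⁻¹ Σ_{x∈B(y)} f(x)` of `N` values is bounded by their sup (the sup norm
is Mathlib's norm on `ι → ℝ`). [cite: Dimock2013, §2.1 L317–321 (arXiv:1108.1335v2 TeX)] -/
theorem abs_QD_le {b : ι → σ} {N : ℕ} (hb : ∀ y, (fibre b y).card = N) (hN : 0 < N) (f : ι → ℝ) (y : σ) :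
    |QD b N f y| ≤ ‖f‖ := by
  have hNr : (0 : ℝ) < N := by exact_mod_cast hN
  have hf : ∀ x, |f x| ≤ ‖f‖ := fun x => by simpa [Real.norm_eq_abs] using norm_le_pi_norm f x
  unfold QD
  rw [abs_mul, abs_of_pos (inv_pos.2 hNr)]
  calc (N : ℝ)⁻¹ * |∑ x ∈ fibre b y, f x| ≤ (N : ℝ)⁻¹ * ∑ x ∈ fibre b y, |f x| :=
        mul_le_mul_of_nonneg_left (Finset.abs_sum_le_sum_abs _ _) (inv_pos.2 hNr).le
    _ ≤ (N : ℝ)⁻¹ * ∑ _x ∈ fibre b y, ‖f‖ :=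
        mul_le_mul_of_nonneg_left (Finset.sum_le_sum fun x _ => hf x) (inv_pos.2 hNr).le
    _ = ‖f‖ := by
        rw [Finset.sum_const, hb y, nsmul_eq_mul, ← mul_assoc, inv_mul_cancel₀ hNr.ne', one_mul]

omit [Fintype ι] [Fintype σ] [DecidableEq ι] [DecidableEq σ] in
/-- `|(Qᵀg)(x)| = |g(b x)| ≤ ‖g‖_∞`. [cite: Dimock2013, §2.1 L328–334 (arXiv:1108.1335v2 TeX)] -/
theorem abs_QDT_le [Fintype σ] (b : ι → σ) (g : σ → ℝ) (x : ι) : |QDT b g x| ≤ ‖g‖ := by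
  simpa [QDT, Real.norm_eq_abs] using norm_le_pi_norm g (b x)

omit [Fintype σ] [DecidableEq ι] in
/-- **`|(QᵀQ f)(x)| ≤ ‖f‖_∞`** in the isometric matrix form: the projection `Qmatᵀ Qmat = QᵀQ` (`Qmat_proj_mulVec`) is the
block average pulled back, hence a sup-norm contraction — with (three) this gives `|A_{k,r}W| ≤ 2(a_k + r)^{−1}‖W‖_∞`
(`CovarianceSquareRoot.abs_Akr_mulVec_le`). [cite: Dimock2013, §2.1 L335–336 and §4.3 Lemma 11 proof L2204
(arXiv:1108.1335v2 TeX)] -/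
theorem abs_proj_Qmat_mulVec_le [Fintype σ] {b : ι → σ} {N : ℕ} (hb : ∀ y, (fibre b y).card = N) (hN : 0 < N)
    (f : ι → ℝ) (x : ι) : |(((Qmat b N)ᵀ * Qmat b N) *ᵥ f) x| ≤ ‖f‖ := by
  rw [Qmat_proj_mulVec b hN f]
  exact abs_QD_le hb hN f (b x)

end Literature.MathematicalPhysics.QuantumFieldTheory.Dimock2011to13.BlockAveragingMatrix

end
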